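import Literature.NumberTheory.EllipticCurves.ThreeTorsionInertiaStructureProofs
import Literature.NumberTheory.GaloisRepresentations.RamificationCertificatesProofs
import HarnessLib

/-!
# Fake-point toolkit: radicals of `E[3]` in `K̄`, integral generators of `S_E`, units at `𝔓 ∣ 2`,
# and `#Q₁ = 4` for general square classes

`Proofs` file (theorems only, no definitions, no named facts) in topic
`NumberTheory/EllipticCurves`, landed by the seat of bsd.S15
(`Literature.NumberTheory.EllipticCurves.conductorNorm_eq_artinConductorNat_of_isElliptic`): the
small interface through which the per-congruence-class files feed
`ThreeTorsionInertiaStructureProofs` and `ThreeTorsionFakePointProductsProofs` (Ogg's formula at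
`2`, Galois side, for `j ≠ 0, 1728`):

* `exists_radical_algebraicClosure` — radicals `ζ, δ, R₀, R₁, R₂ ∈ K̄` of `E[3]`
  (`ThreeTorsionRadicalProofs.exists_radical` for the base change);
* `exists_integralClosure_xDivisionField_of_pow_eq`, `exists_integralClosure_xDivisionField_radical`
  — elements of `S_E = integralClosure 𝓞_K K(x(E[3]))` with prescribed values (`xⁿ ∈ 𝓞_K`;
  `ζ, δ, R_k` when `Δ, c₄ ∈ 𝓞_K`);
* `zeta_notMem_and_one_add_two_mul_zeta_notMem`, `intCast_notMem_of_odd` — `ζ`, `1 + 2ζ = √-3` and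
  odd rational integers are units at a prime `𝔓 ∣ 2` with `3 ∉ 𝔓`;
* `card_ramificationSubgroup_one_xDivisionField_three_eq_four_of_sq` — the variant of
  `card_ramificationSubgroup_one_xDivisionField_three_eq_four` (`#Q₁ = 4` from three odd quadratic
  defects) for square classes `A_k = (q_k R_k)²`, `q_k ∈ E` fixed by the `σ` fixing `ζ, δ`
  (needed near `j = 1728`, where `c₄ - 12δ` cancels and one uses `A₀ = c₆²(c₄ - 12ζδ)(c₄ - 12ζ²δ)
  = ((c₄ - 12ζδ)(c₄ - 12ζ²δ) R₀)²`).

Instance convention as in `ThreeTorsionFakePointSwanProofs`.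

## References
* J.-P. Serre, *Local Fields*, GTM 67, Springer 1979, Ch. I §7, Ch. IV §1–§2.
  [cite: SerreLocalFields1979, Ch. IV §1–§2]
* J. H. Silverman, *Advanced Topics in the Arithmetic of Elliptic Curves*, GTM 151, Springer 1994,
  Ch. IV §11 (Ogg's formula, Thm. 11.1). [cite: SilvermanATAEC1994, Thm. IV.11.1]
-/

noncomputable section

open scoped Classical NumberField Pointwise
open Field IsDedekindDomain Polynomial

attribute [local instance] AddSubgroup.torsionBy.zmodModule
attribute [local instance 1001] IntermediateField.algebra'
attribute [local instance 1002] AlgebraicClosure.instAlgebra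

namespace WeierstrassCurve

open Literature.NumberTheory.EllipticCurves Literature.NumberTheory.GaloisRepresentations

variable {K : Type} [Field K] [NumberField K] (W : WeierstrassCurve K)

omit [NumberField K] in
/-- **Radicals of `E[3]` in `K̄`**: `ζ² + ζ + 1 = 0`, `δ³ = Δ`, `R_k² = c₄ - 12ζ^kδ`, `R₀R₁R₂ = c₆`
(`exists_radical` for the base change to `K̄`). [folklore] -/
theorem exists_radical_algebraicClosure :
    ∃ ζ δ R₀ R₁ R₂ : AlgebraicClosure K, ζ ^ 2 + ζ + 1 = 0 ∧
      δ ^ 3 = algebraMap K (AlgebraicClosure K) W.Δ ∧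
      R₀ ^ 2 = algebraMap K (AlgebraicClosure K) W.c₄ - 12 * δ ∧
      R₁ ^ 2 = algebraMap K (AlgebraicClosure K) W.c₄ - 12 * ζ * δ ∧
      R₂ ^ 2 = algebraMap K (AlgebraicClosure K) W.c₄ - 12 * ζ ^ 2 * δ ∧
      R₀ * R₁ * R₂ = algebraMap K (AlgebraicClosure K) W.c₆ := by
  obtain ⟨ζ, δ, R₀, R₁, R₂, hζ, hδ, h₀, h₁, h₂, hρ⟩ := (W.baseChange (AlgebraicClosure K)).exists_radical
  obtain ⟨-, ec₄, ec₆, eΔ⟩ := W.baseChange_algebraicClosure_invariants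
  exact ⟨ζ, δ, R₀, R₁, R₂, hζ, by rw [hδ, eΔ], by rw [h₀, ec₄], by rw [h₁, ec₄], by rw [h₂, ec₄],
    by rw [hρ, ec₆]⟩

omit [NumberField K] in
/-- **Integral elements of `E = K(x(E[3]))` from a power relation**: an `x ∈ E` with
`xⁿ = r ∈ 𝓞_K` (`n > 0`) lies in `S_E = integralClosure 𝓞_K E`. [folklore] -/
theorem exists_integralClosure_xDivisionField_of_pow_eq {x : AlgebraicClosure K}
    (hx : x ∈ W.xDivisionField 3) {n : ℕ} (hn : 0 < n) {r : 𝓞 K}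
    (hxn : x ^ n = algebraMap K (AlgebraicClosure K) (algebraMap (𝓞 K) K r)) :
    ∃ X : integralClosure (𝓞 K) (W.xDivisionField 3),
      ((X : W.xDivisionField 3) : AlgebraicClosure K) = x := by
  have hval : ((algebraMap (𝓞 K) (W.xDivisionField 3) r : W.xDivisionField 3) : AlgebraicClosure K) =
      algebraMap K (AlgebraicClosure K) (algebraMap (𝓞 K) K r) := rfl
  have hpow : (⟨x, hx⟩ : W.xDivisionField 3) ^ n = algebraMap (𝓞 K) (W.xDivisionField 3) r :=
    Subtype.ext (by push_cast; rw [hxn]; exact hval.symm)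
  have hint : _root_.IsIntegral (𝓞 K) (⟨x, hx⟩ : W.xDivisionField 3) :=
    IsIntegral.of_pow hn (by rw [hpow]; exact isIntegral_algebraMap)
  exact ⟨⟨⟨x, hx⟩, hint⟩, rfl⟩

/-- **Integral generators**: `ζ, δ, R₀, R₁, R₂ ∈ S_E` when `Δ = D` and `c₄ = C₄` lie in `𝓞_K`
(`ζ³ = 1`, `δ³ = D`, `R_k² = C₄ - 12ζ^kδ`). [folklore] -/
theorem exists_integralClosure_xDivisionField_radical [W.IsElliptic]
    {ζ δ R₀ R₁ R₂ : AlgebraicClosure K} (hζ : ζ ^ 2 + ζ + 1 = 0)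
    (hδ : δ ^ 3 = algebraMap K (AlgebraicClosure K) W.Δ)
    (h₀ : R₀ ^ 2 = algebraMap K (AlgebraicClosure K) W.c₄ - 12 * δ)
    (h₁ : R₁ ^ 2 = algebraMap K (AlgebraicClosure K) W.c₄ - 12 * ζ * δ)
    (h₂ : R₂ ^ 2 = algebraMap K (AlgebraicClosure K) W.c₄ - 12 * ζ ^ 2 * δ)
    (hρ : R₀ * R₁ * R₂ = algebraMap K (AlgebraicClosure K) W.c₆)
    {D C₄ : 𝓞 K} (hD : algebraMap (𝓞 K) K D = W.Δ) (hC₄ : algebraMap (𝓞 K) K C₄ = W.c₄) :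
    ∃ ζE δE R₀E R₁E R₂E : integralClosure (𝓞 K) (W.xDivisionField 3),
      ((ζE : W.xDivisionField 3) : AlgebraicClosure K) = ζ ∧
      ((δE : W.xDivisionField 3) : AlgebraicClosure K) = δ ∧
      ((R₀E : W.xDivisionField 3) : AlgebraicClosure K) = R₀ ∧
      ((R₁E : W.xDivisionField 3) : AlgebraicClosure K) = R₁ ∧
      ((R₂E : W.xDivisionField 3) : AlgebraicClosure K) = R₂ := by
  have h2K : (2 : K) ≠ 0 := two_ne_zero
  have h3K : (3 : K) ≠ 0 := three_ne_zero
  obtain ⟨mR₀, mR₁, mR₂⟩ := W.radical_mem_xDivisionField_three h2K h3K hζ hδ h₀ h₁ h₂ hρ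
  obtain ⟨mζ, mδ⟩ := W.zeta_mem_and_delta_mem_xDivisionField_three h2K h3K hζ hδ h₀ h₁ h₂ hρ
  have hζ3 : ζ ^ 3 = 1 := by linear_combination (ζ - 1) * hζ
  obtain ⟨ζE, hζE⟩ := W.exists_integralClosure_xDivisionField_of_pow_eq mζ three_pos (r := 1)
    (by rw [hζ3, map_one, map_one])
  obtain ⟨δE, hδE⟩ := W.exists_integralClosure_xDivisionField_of_pow_eq mδ three_pos (r := D)
    (by rw [hδ, hD])
  have hinjE : ∀ {X Y : integralClosure (𝓞 K) (W.xDivisionField 3)},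
      ((X : W.xDivisionField 3) : AlgebraicClosure K) = ((Y : W.xDivisionField 3) : AlgebraicClosure K) →
        X = Y := fun h => Subtype.ext (Subtype.ext h)
  -- `R_k`: square roots of the integral elements `C₄ - 12 ζ^k δ`
  have hC₄val : ((algebraMap (𝓞 K) (W.xDivisionField 3) C₄ : W.xDivisionField 3) : AlgebraicClosure K) =
      algebraMap K (AlgebraicClosure K) W.c₄ := by rw [← hC₄]; rfl
  have hRint : ∀ (R : AlgebraicClosure K) (mR : R ∈ W.xDivisionField 3) (k : ℕ),
      R ^ 2 = algebraMap K (AlgebraicClosure K) W.c₄ - 12 * ζ ^ k * δ →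
      _root_.IsIntegral (𝓞 K) (⟨R, mR⟩ : W.xDivisionField 3) := by
    intro R mR k hR
    refine IsIntegral.of_pow two_pos ?_
    have hsq : (⟨R, mR⟩ : W.xDivisionField 3) ^ 2 =
        ((algebraMap (𝓞 K) (integralClosure (𝓞 K) (W.xDivisionField 3)) C₄ - 12 * ζE ^ k * δE :
          integralClosure (𝓞 K) (W.xDivisionField 3)) : W.xDivisionField 3) := by
      apply Subtype.ext
      push_cast
      rw [hR, hζE, hδE]
      congr 1
      exact hC₄val.symm
    rw [hsq]
    exact (algebraMap (𝓞 K) (integralClosure (𝓞 K) (W.xDivisionField 3)) C₄ - 12 * ζE ^ k * δE).2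
  refine ⟨ζE, δE, ⟨⟨R₀, mR₀⟩, hRint R₀ mR₀ 0 (by rw [h₀, pow_zero, mul_one])⟩,
    ⟨⟨R₁, mR₁⟩, hRint R₁ mR₁ 1 (by rw [h₁, pow_one])⟩, ⟨⟨R₂, mR₂⟩, hRint R₂ mR₂ 2 h₂⟩,
    hζE, hδE, rfl, rfl, rfl⟩

/-- **Units at `𝔓 ∣ 2`**: `ζ ∉ 𝔓_E` and `1 + 2ζ ∉ 𝔓_E` (`ζ³ = 1`, `(1 + 2ζ)² = -3`, `3 ∉ 𝔓`).
[folklore] -/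
theorem zeta_notMem_and_one_add_two_mul_zeta_notMem
    {v : HeightOneSpectrum (𝓞 K)} (h3 : ((3 : ℕ) : 𝓞 K) ∉ v.asIdeal)
    {𝔓 : Ideal (absIntegers (𝓞 K) K)} (h𝔓 : 𝔓 ∈ v.primesAbove)
    {ζE : integralClosure (𝓞 K) (W.xDivisionField 3)} (hζE : ζE ^ 2 + ζE + 1 = 0) :
    ζE ∉ 𝔓.comap ((W.xDivisionField 3).integralClosureToAbsIntegers (𝓞 K)) ∧
      1 + 2 * ζE ∉ 𝔓.comap ((W.xDivisionField 3).integralClosureToAbsIntegers (𝓞 K)) := by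
  haveI : 𝔓.IsPrime := h𝔓.1
  haveI h𝔓max : 𝔓.IsMaximal := HeightOneSpectrum.isMaximal_of_mem_primesAbove h𝔓
  haveI hPEmax : (𝔓.comap ((W.xDivisionField 3).integralClosureToAbsIntegers (𝓞 K))).IsMaximal :=
    isMaximal_comap_integralClosureToAbsIntegers (𝓞 K) 𝔓 (W.xDivisionField 3)
  have hunderE : (𝔓.comap ((W.xDivisionField 3).integralClosureToAbsIntegers (𝓞 K))).under (𝓞 K) = v.asIdeal := by
    rw [under_comap_integralClosureToAbsIntegers, ← h𝔓.2.over]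
  have h3E : (3 : integralClosure (𝓞 K) (W.xDivisionField 3)) ∉
      𝔓.comap ((W.xDivisionField 3).integralClosureToAbsIntegers (𝓞 K)) := by
    intro hmem
    apply h3
    rw [← hunderE, Ideal.under_def, Ideal.mem_comap, map_natCast]
    exact_mod_cast hmem
  have hζE3 : ζE ^ 3 = 1 := by linear_combination (ζE - 1) * hζE
  have hζunit : ζE ∉ 𝔓.comap ((W.xDivisionField 3).integralClosureToAbsIntegers (𝓞 K)) := by
    intro h
    have h1 : (1 : integralClosure (𝓞 K) (W.xDivisionField 3)) ∈
        𝔓.comap ((W.xDivisionField 3).integralClosureToAbsIntegers (𝓞 K)) := by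
      rw [← hζE3, pow_succ]
      exact Ideal.mul_mem_left _ _ h
    exact hPEmax.ne_top ((Ideal.eq_top_iff_one _).mpr h1)
  refine ⟨hζunit, fun h => ?_⟩
  have hsq : (1 + 2 * ζE) * (1 + 2 * ζE) = -3 := by linear_combination 4 * hζE
  have := Ideal.mul_mem_left _ (1 + 2 * ζE) h
  rw [hsq] at this
  exact h3E (neg_mem_iff.mp this)

/-- **Rational integers prime to `2` are units at `𝔓 ∣ 2`**: `(m : S_E) ∉ 𝔓_E` for odd `m : ℤ`.
[folklore] -/
theorem intCast_notMem_of_odd {v : HeightOneSpectrum (𝓞 K)} (hv2 : (2 : 𝓞 K) ∈ v.asIdeal)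
    {𝔓 : Ideal (absIntegers (𝓞 K) K)} (h𝔓 : 𝔓 ∈ v.primesAbove) {m : ℤ} (hm : Odd m) :
    ((m : integralClosure (𝓞 K) (W.xDivisionField 3))) ∉
      𝔓.comap ((W.xDivisionField 3).integralClosureToAbsIntegers (𝓞 K)) := by
  haveI : 𝔓.IsPrime := h𝔓.1
  haveI h𝔓max : 𝔓.IsMaximal := HeightOneSpectrum.isMaximal_of_mem_primesAbove h𝔓
  haveI hPEmax : (𝔓.comap ((W.xDivisionField 3).integralClosureToAbsIntegers (𝓞 K))).IsMaximal :=
    isMaximal_comap_integralClosureToAbsIntegers (𝓞 K) 𝔓 (W.xDivisionField 3)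
  have hunderE : (𝔓.comap ((W.xDivisionField 3).integralClosureToAbsIntegers (𝓞 K))).under (𝓞 K) = v.asIdeal := by
    rw [under_comap_integralClosureToAbsIntegers, ← h𝔓.2.over]
  have h2E : (2 : integralClosure (𝓞 K) (W.xDivisionField 3)) ∈
      𝔓.comap ((W.xDivisionField 3).integralClosureToAbsIntegers (𝓞 K)) := by
    have : (2 : 𝓞 K) ∈ (𝔓.comap ((W.xDivisionField 3).integralClosureToAbsIntegers (𝓞 K))).under (𝓞 K) := by
      rw [hunderE]; exact hv2
    rw [Ideal.under_def, Ideal.mem_comap, map_ofNat] at this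
    exact this
  intro h
  obtain ⟨k, hk⟩ := hm
  have h1 : (1 : integralClosure (𝓞 K) (W.xDivisionField 3)) ∈
      𝔓.comap ((W.xDivisionField 3).integralClosureToAbsIntegers (𝓞 K)) := by
    have e : (1 : integralClosure (𝓞 K) (W.xDivisionField 3)) = (m : integralClosure (𝓞 K) (W.xDivisionField 3)) - 2 * (k : integralClosure (𝓞 K) (W.xDivisionField 3)) := by
      rw [hk]; push_cast; ring
    rw [e]
    exact Ideal.sub_mem _ h (Ideal.mul_mem_right _ _ h2E)
  exact hPEmax.ne_top ((Ideal.eq_top_iff_one _).mpr h1)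

set_option maxHeartbeats 1600000 in
set_option synthInstance.maxHeartbeats 400000 in
/-- **`#Q₁(𝔓 ∩ K(x(E[3]))) = 4` from three odd quadratic defects, general square classes.**
Variant of `card_ramificationSubgroup_one_xDivisionField_three_eq_four` in which the element `A_k`
is `(q_k R_k)²` for any `q_k ∈ E` fixed by the `σ ∈ Γ_K` fixing `ζ, δ` (e.g. `q₀ = A₁A₂`,
`A₀ = c₆² A₁ A₂`, avoiding the cancellation in `c₄ - 12δ` near `j = 1728`); same proof with
`R_k ↦ q_k R_k`.  Original statement:   `K` a number field, `v ∣ 2`,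
`3 ∉ v`, `𝔓 ∣ v` a prime of `\bar ℤ_K`, radicals `ζ, δ, R_k` of `E[3]` with `c₆ ≠ 0`, `π ∈ v ∖ v²`;
elements `A_k, s_k ∈ S_E` (`E = K(x(E[3]))`) with `A_k = c₄ - 12ζ^kδ`, `s_k` fixed by every
`σ ∈ Γ_K` fixing `ζ` and `δ`, and natural numbers `e₀, t_k` odd with
`e₀ · v_{𝔓_E}(A_k - s_k²) = t_k · v_{𝔓_E}(π)` and `v_{𝔓_E}(A_k - s_k²) ≤ 2 v_{𝔓_E}(2 s_k)`
(`k = 0, 1, 2`).  Then the wild inertia group of `𝔓 ∩ E` has order `4` (it is the four-group of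
even sign changes of `(R₀, R₁, R₂)`).
Proof: `Q₁` embeds in `{±1}²` (it fixes `ζ, δ`); if `#Q₁ ≤ 2` it fixes some `R_k`; in the fixed
field `T` of `Q₁`, `v_{𝔓_E} = #Q₁ · v_{𝔓_T}` on `S_T` and `v_{𝔓_T}(π) = #Q₀ / #Q₁` is odd
(`#Q₁ = 2^{v₂(#Q₀)}`), so `v_{𝔓_T}(A_k - s_k²)·e₀ = t_k v_{𝔓_T}(π)` is odd, while
`2 v_{𝔓_T}(R_k - s_k) = v_{𝔓_T}(A_k - s_k²)` (one-slope lemma).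
Ref: Serre, *Local Fields*, Ch. I §7 Prop. 21–22, Ch. IV §2 Cor. 3; Neukirch, *ANT* II (6.3).
[cite: SerreLocalFields1979, Ch. I §7 Prop. 22] -/
theorem card_ramificationSubgroup_one_xDivisionField_three_eq_four_of_sq [W.IsElliptic]
    {v : HeightOneSpectrum (𝓞 K)} (hv2 : (2 : 𝓞 K) ∈ v.asIdeal) (h3 : ((3 : ℕ) : 𝓞 K) ∉ v.asIdeal)
    {𝔓 : Ideal (absIntegers (𝓞 K) K)} (h𝔓 : 𝔓 ∈ v.primesAbove)
    {ζ δ R₀ R₁ R₂ : AlgebraicClosure K} (hζ : ζ ^ 2 + ζ + 1 = 0)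
    (hδ : δ ^ 3 = algebraMap K (AlgebraicClosure K) W.Δ)
    (h₀ : R₀ ^ 2 = algebraMap K (AlgebraicClosure K) W.c₄ - 12 * δ)
    (h₁ : R₁ ^ 2 = algebraMap K (AlgebraicClosure K) W.c₄ - 12 * ζ * δ)
    (h₂ : R₂ ^ 2 = algebraMap K (AlgebraicClosure K) W.c₄ - 12 * ζ ^ 2 * δ)
    (hρ : R₀ * R₁ * R₂ = algebraMap K (AlgebraicClosure K) W.c₆) (hc₆ : W.c₆ ≠ 0)
    {π : 𝓞 K} (hπ : π ∈ v.asIdeal) (hπ2 : π ∉ v.asIdeal ^ 2)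
    {q₀ q₁ q₂ : AlgebraicClosure K} (mq₀ : q₀ ∈ W.xDivisionField 3) (mq₁ : q₁ ∈ W.xDivisionField 3)
    (mq₂ : q₂ ∈ W.xDivisionField 3)
    (hq₀ : ∀ σ : absoluteGaloisGroup K, σ • ζ = ζ → σ • δ = δ → σ • q₀ = q₀)
    (hq₁ : ∀ σ : absoluteGaloisGroup K, σ • ζ = ζ → σ • δ = δ → σ • q₁ = q₁)
    (hq₂ : ∀ σ : absoluteGaloisGroup K, σ • ζ = ζ → σ • δ = δ → σ • q₂ = q₂)
    {A₀ A₁ A₂ s₀ s₁ s₂ : integralClosure (𝓞 K) (W.xDivisionField 3)}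
    (hA₀ : ((A₀ : W.xDivisionField 3) : AlgebraicClosure K) = (q₀ * R₀) ^ 2)
    (hA₁ : ((A₁ : W.xDivisionField 3) : AlgebraicClosure K) = (q₁ * R₁) ^ 2)
    (hA₂ : ((A₂ : W.xDivisionField 3) : AlgebraicClosure K) = (q₂ * R₂) ^ 2)
    (hs₀ : ∀ σ : absoluteGaloisGroup K, σ • ζ = ζ → σ • δ = δ →
      σ • ((s₀ : W.xDivisionField 3) : AlgebraicClosure K) = ((s₀ : W.xDivisionField 3) : AlgebraicClosure K))
    (hs₁ : ∀ σ : absoluteGaloisGroup K, σ • ζ = ζ → σ • δ = δ →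
      σ • ((s₁ : W.xDivisionField 3) : AlgebraicClosure K) = ((s₁ : W.xDivisionField 3) : AlgebraicClosure K))
    (hs₂ : ∀ σ : absoluteGaloisGroup K, σ • ζ = ζ → σ • δ = δ →
      σ • ((s₂ : W.xDivisionField 3) : AlgebraicClosure K) = ((s₂ : W.xDivisionField 3) : AlgebraicClosure K))
    {e₀ t₀ t₁ t₂ : ℕ} (he₀ : Odd e₀) (hto₀ : Odd t₀) (hto₁ : Odd t₁) (hto₂ : Odd t₂)
    (ht₀ : (e₀ : ℕ∞) * ord (𝔓.comap ((W.xDivisionField 3).integralClosureToAbsIntegers (𝓞 K))) (A₀ - s₀ ^ 2) =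
      t₀ * ord (𝔓.comap ((W.xDivisionField 3).integralClosureToAbsIntegers (𝓞 K)))
        (algebraMap (𝓞 K) (integralClosure (𝓞 K) (W.xDivisionField 3)) π))
    (ht₁ : (e₀ : ℕ∞) * ord (𝔓.comap ((W.xDivisionField 3).integralClosureToAbsIntegers (𝓞 K))) (A₁ - s₁ ^ 2) =
      t₁ * ord (𝔓.comap ((W.xDivisionField 3).integralClosureToAbsIntegers (𝓞 K)))
        (algebraMap (𝓞 K) (integralClosure (𝓞 K) (W.xDivisionField 3)) π))
    (ht₂ : (e₀ : ℕ∞) * ord (𝔓.comap ((W.xDivisionField 3).integralClosureToAbsIntegers (𝓞 K))) (A₂ - s₂ ^ 2) =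
      t₂ * ord (𝔓.comap ((W.xDivisionField 3).integralClosureToAbsIntegers (𝓞 K)))
        (algebraMap (𝓞 K) (integralClosure (𝓞 K) (W.xDivisionField 3)) π))
    (hle₀ : ord (𝔓.comap ((W.xDivisionField 3).integralClosureToAbsIntegers (𝓞 K))) (A₀ - s₀ ^ 2) ≤
      2 * ord (𝔓.comap ((W.xDivisionField 3).integralClosureToAbsIntegers (𝓞 K))) (2 * s₀))
    (hle₁ : ord (𝔓.comap ((W.xDivisionField 3).integralClosureToAbsIntegers (𝓞 K))) (A₁ - s₁ ^ 2) ≤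
      2 * ord (𝔓.comap ((W.xDivisionField 3).integralClosureToAbsIntegers (𝓞 K))) (2 * s₁))
    (hle₂ : ord (𝔓.comap ((W.xDivisionField 3).integralClosureToAbsIntegers (𝓞 K))) (A₂ - s₂ ^ 2) ≤
      2 * ord (𝔓.comap ((W.xDivisionField 3).integralClosureToAbsIntegers (𝓞 K))) (2 * s₂)) :
    Nat.card ((𝔓.comap ((W.xDivisionField 3).integralClosureToAbsIntegers (𝓞 K))).ramificationSubgroup
      (W.xDivisionField 3 ≃ₐ[K] W.xDivisionField 3) 1) = 4 := by
  classical
  haveI : Fact (Nat.Prime 3) := ⟨Nat.prime_three⟩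
  have h2K : (2 : K) ≠ 0 := two_ne_zero
  have h3K : (3 : K) ≠ 0 := three_ne_zero
  -- instances for `E = K(x(E[3]))`
  haveI hDDE : IsDedekindDomain (integralClosure (𝓞 K) (W.xDivisionField 3)) :=
    integralClosure.isDedekindDomain (𝓞 K) K (W.xDivisionField 3)
  haveI : 𝔓.IsPrime := h𝔓.1
  haveI h𝔓max : 𝔓.IsMaximal := HeightOneSpectrum.isMaximal_of_mem_primesAbove h𝔓
  haveI : IsGalois K (W.xDivisionField 3) := {}
  haveI hPEmax : (𝔓.comap ((W.xDivisionField 3).integralClosureToAbsIntegers (𝓞 K))).IsMaximal :=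
    isMaximal_comap_integralClosureToAbsIntegers (𝓞 K) 𝔓 (W.xDivisionField 3)
  have hunderE : (𝔓.comap ((W.xDivisionField 3).integralClosureToAbsIntegers (𝓞 K))).under (𝓞 K) = v.asIdeal := by
    rw [under_comap_integralClosureToAbsIntegers, ← h𝔓.2.over]
  have hPE0 : (𝔓.comap ((W.xDivisionField 3).integralClosureToAbsIntegers (𝓞 K))) ≠ ⊥ := by
    intro h0
    have hinj : Function.Injective (algebraMap (𝓞 K) (integralClosure (𝓞 K) (W.xDivisionField 3))) :=
      (faithfulSMul_iff_algebraMap_injective _ _).mp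
        (faithfulSMul_integralClosure (𝓞 K) (K := K) (L := (W.xDivisionField 3)))
    have h2' : (2 : 𝓞 K) ∈ (𝔓.comap ((W.xDivisionField 3).integralClosureToAbsIntegers (𝓞 K))).under (𝓞 K) := by
      rw [hunderE]; exact hv2
    rw [Ideal.under_def, Ideal.mem_comap, h0, Ideal.mem_bot] at h2'
    exact two_ne_zero (hinj (h2'.trans (map_zero _).symm))
  haveI : Finite ((𝓞 K) ⧸ 𝔓.under (𝓞 K)) := by
    rw [← h𝔓.2.over]; exact Ideal.finiteQuotientOfFreeOfNeBot v.asIdeal v.ne_bot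
  haveI hsepE : Algebra.IsSeparable
      ((𝓞 K) ⧸ (𝔓.comap ((W.xDivisionField 3).integralClosureToAbsIntegers (𝓞 K))).under (𝓞 K))
      (integralClosure (𝓞 K) (W.xDivisionField 3) ⧸
        𝔓.comap ((W.xDivisionField 3).integralClosureToAbsIntegers (𝓞 K))) :=
    isSeparable_residue_comap (𝓞 K) 𝔓 (W.xDivisionField 3)
  -- radicals in `E`
  obtain ⟨mR₀, mR₁, mR₂⟩ := W.radical_mem_xDivisionField_three h2K h3K hζ hδ h₀ h₁ h₂ hρ
  have hRne : R₀ ≠ 0 ∧ R₁ ≠ 0 ∧ R₂ ≠ 0 := by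
    have hprod : R₀ * R₁ * R₂ ≠ 0 := by
      rw [hρ]; exact (_root_.map_ne_zero _).mpr hc₆
    exact ⟨fun h => hprod (by rw [h]; ring), fun h => hprod (by rw [h]; ring), fun h => hprod (by rw [h]; ring)⟩
  have hρσ : ∀ σ : absoluteGaloisGroup K, (σ • R₀) * (σ • R₁) * (σ • R₂) = R₀ * R₁ * R₂ := by
    intro σ
    rw [← smul_mul', ← smul_mul', hρ, smul_algebraMap]
  have hres : ∀ (g : W.xDivisionField 3 ≃ₐ[K] W.xDivisionField 3) (σ : absoluteGaloisGroup K),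
      absRestrictNormalHom (W.xDivisionField 3) σ = g →
      ∀ X : integralClosure (𝓞 K) (W.xDivisionField 3),
        (((g • X : integralClosure (𝓞 K) (W.xDivisionField 3)) : W.xDivisionField 3) : AlgebraicClosure K) =
          σ • ((X : W.xDivisionField 3) : AlgebraicClosure K) := by
    intro g σ hσ X
    rw [integralClosure.coe_smul, ← hσ]
    exact AlgEquiv.restrictNormal_commutes (absoluteGaloisGroup.toAlgEquiv K σ) (W.xDivisionField 3) X
  have hresf : ∀ (g : W.xDivisionField 3 ≃ₐ[K] W.xDivisionField 3) (σ : absoluteGaloisGroup K),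
      absRestrictNormalHom (W.xDivisionField 3) σ = g →
      ∀ e : W.xDivisionField 3, ((g e : W.xDivisionField 3) : AlgebraicClosure K) =
        σ • (e : AlgebraicClosure K) := by
    intro g σ hσ e
    rw [← hσ]
    exact AlgEquiv.restrictNormal_commutes (absoluteGaloisGroup.toAlgEquiv K σ) (W.xDivisionField 3) e
  have hinjE : ∀ {X Y : integralClosure (𝓞 K) (W.xDivisionField 3)},
      ((X : W.xDivisionField 3) : AlgebraicClosure K) = ((Y : W.xDivisionField 3) : AlgebraicClosure K) →
        X = Y := fun h => Subtype.ext (Subtype.ext h)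
  -- `Q₁`, its elements fix `ζ, δ`
  obtain ⟨Q1, hQ1⟩ : ∃ Q1 : Subgroup (W.xDivisionField 3 ≃ₐ[K] W.xDivisionField 3),
      Q1 = (𝔓.comap ((W.xDivisionField 3).integralClosureToAbsIntegers (𝓞 K))).ramificationSubgroup
        (W.xDivisionField 3 ≃ₐ[K] W.xDivisionField 3) 1 := ⟨_, rfl⟩
  rw [← hQ1]
  have hmem1 : ∀ g, g ∈ Q1 → g ∈ (𝔓.comap ((W.xDivisionField 3).integralClosureToAbsIntegers (𝓞 K))).ramificationSubgroup
      (W.xDivisionField 3 ≃ₐ[K] W.xDivisionField 3) 1 := fun g hg => hQ1 ▸ hg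
  have hQ10 : ∀ g, g ∈ Q1 → g ∈ (𝔓.comap ((W.xDivisionField 3).integralClosureToAbsIntegers (𝓞 K))).ramificationSubgroup
      (W.xDivisionField 3 ≃ₐ[K] W.xDivisionField 3) 0 :=
    fun g hg => Ideal.ramificationSubgroup_antitone _ _ (Nat.zero_le 1) (hmem1 g hg)
  have hliftfix : ∀ g, g ∈ Q1 → ∀ σ : absoluteGaloisGroup K, absRestrictNormalHom (W.xDivisionField 3) σ = g →
      σ • ζ = ζ ∧ σ • δ = δ := fun g hg σ hσ =>
    ⟨W.smul_zeta_eq_of_mem_inertia_xDivisionField_three h3 h𝔓 hζ hδ h₀ h₁ h₂ hρ (hQ10 g hg) σ hσ,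
     W.smul_delta_eq_of_mem_ramificationSubgroup_one_xDivisionField_three hv2 h3 h𝔓 hζ hδ h₀ h₁ h₂ hρ
      (hmem1 g hg) σ hσ⟩
  -- the sign map `Q₁ → {±1}²` is injective: `#Q₁ ≤ 4`
  have hval : ∀ (g : W.xDivisionField 3 ≃ₐ[K] W.xDivisionField 3) (σ : absoluteGaloisGroup K),
      absRestrictNormalHom (W.xDivisionField 3) σ = g → ∀ (R : AlgebraicClosure K) (hR : R ∈ W.xDivisionField 3),
      (g ⟨R, hR⟩ = ⟨R, hR⟩ ↔ σ • R = R) := by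
    intro g σ hσ R hR
    rw [Subtype.ext_iff, hresf g σ hσ]
  let f : Q1 → Bool × Bool := fun g =>
    (decide ((g : W.xDivisionField 3 ≃ₐ[K] W.xDivisionField 3) ⟨R₀, mR₀⟩ = ⟨R₀, mR₀⟩),
     decide ((g : W.xDivisionField 3 ≃ₐ[K] W.xDivisionField 3) ⟨R₁, mR₁⟩ = ⟨R₁, mR₁⟩))
  have hf_inj : Function.Injective f := by
    rintro ⟨g, hg⟩ ⟨g', hg'⟩ hgg'
    simp only [f, Prod.mk.injEq, decide_eq_decide] at hgg'
    obtain ⟨e0, e1⟩ := hgg'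
    obtain ⟨σ, hσ⟩ := absRestrictNormalHom_surjective' (W.xDivisionField 3) g
    obtain ⟨σ', hσ'⟩ := absRestrictNormalHom_surjective' (W.xDivisionField 3) g'
    obtain ⟨fζ, fδ⟩ := hliftfix g hg σ hσ
    obtain ⟨fζ', fδ'⟩ := hliftfix g' hg' σ' hσ'
    obtain ⟨s0, s1, -⟩ := W.smul_radical_eq_or_eq_neg h₀ h₁ h₂ fζ fδ
    obtain ⟨s0', s1', -⟩ := W.smul_radical_eq_or_eq_neg h₀ h₁ h₂ fζ' fδ'
    rw [hval g σ hσ, hval g' σ' hσ'] at e0 e1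
    have a0 : σ • R₀ = σ' • R₀ := by
      rcases s0 with h | h
      · rw [h, e0.mp h]
      · rcases s0' with h' | h'
        · rw [h', e0.mpr h']
        · rw [h, h']
    have a1 : σ • R₁ = σ' • R₁ := by
      rcases s1 with h | h
      · rw [h, e1.mp h]
      · rcases s1' with h' | h'
        · rw [h', e1.mpr h']
        · rw [h, h']
    exact Subtype.ext (W.algEquiv_xDivisionField_three_eq_of_smul_radical_eq hζ hδ h₀ h₁ h₂ hρ hc₆ hσ hσ' a0 a1)
  have hle4 : Nat.card Q1 ≤ 4 := by
    have h := Nat.card_le_card_of_injective f hf_inj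
    rwa [Nat.card_prod, show Nat.card Bool = 2 by simp] at h
  -- `#Q₁ = 2^a`
  have hcardpow : Nat.card Q1 = 2 ^ (Nat.card ((𝔓.comap ((W.xDivisionField 3).integralClosureToAbsIntegers (𝓞 K))).ramificationSubgroup
      (W.xDivisionField 3 ≃ₐ[K] W.xDivisionField 3) 0)).factorization 2 := by
    rw [hQ1]; exact card_ramificationSubgroup_one_eq_two_pow_of_mem_primesAbove hv2 h𝔓 (W.xDivisionField 3)
  -- `v_{𝔓_E}(π) = #Q₀`
  have hordπ := ord_algebraMap_eq_card_inertia_of_mem_primesAbove h𝔓 (W.xDivisionField 3) hπ hπ2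
  -- the core: no `R ∈ E` with `R² = A`, `R, A, s` fixed by `Q₁`, `e₀ v(A - s²) = t v(π)`, `t` odd
  have core : ∀ (R : AlgebraicClosure K) (mR : R ∈ W.xDivisionField 3)
      (A s : integralClosure (𝓞 K) (W.xDivisionField 3)) (t : ℕ),
      ((A : W.xDivisionField 3) : AlgebraicClosure K) = R ^ 2 →
      (∀ g, g ∈ Q1 → ∀ σ : absoluteGaloisGroup K, absRestrictNormalHom (W.xDivisionField 3) σ = g → σ • R = R) →
      (∀ g, g ∈ Q1 → ∀ σ : absoluteGaloisGroup K, absRestrictNormalHom (W.xDivisionField 3) σ = g →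
        σ • ((A : W.xDivisionField 3) : AlgebraicClosure K) = ((A : W.xDivisionField 3) : AlgebraicClosure K)) →
      (∀ g, g ∈ Q1 → ∀ σ : absoluteGaloisGroup K, absRestrictNormalHom (W.xDivisionField 3) σ = g →
        σ • ((s : W.xDivisionField 3) : AlgebraicClosure K) = ((s : W.xDivisionField 3) : AlgebraicClosure K)) →
      Odd t →
      (e₀ : ℕ∞) * ord (𝔓.comap ((W.xDivisionField 3).integralClosureToAbsIntegers (𝓞 K))) (A - s ^ 2) =
        t * ord (𝔓.comap ((W.xDivisionField 3).integralClosureToAbsIntegers (𝓞 K)))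
          (algebraMap (𝓞 K) (integralClosure (𝓞 K) (W.xDivisionField 3)) π) →
      ord (𝔓.comap ((W.xDivisionField 3).integralClosureToAbsIntegers (𝓞 K))) (A - s ^ 2) ≤
        2 * ord (𝔓.comap ((W.xDivisionField 3).integralClosureToAbsIntegers (𝓞 K))) (2 * s) → False := by
    intro R mR A s t hAR hfixR hfixA hfixs hto ht hle
    -- the fixed field `T₁` of `Q₁` and its ring of integers
    set T₁ : IntermediateField K (W.xDivisionField 3) := IntermediateField.fixedField Q1 with hT₁
    have hfixT : T₁.fixingSubgroup = Q1 := IntermediateField.fixingSubgroup_fixedField Q1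
    have hmemT : ∀ X : integralClosure (𝓞 K) (W.xDivisionField 3),
        (∀ g, g ∈ Q1 → ∀ σ : absoluteGaloisGroup K, absRestrictNormalHom (W.xDivisionField 3) σ = g →
          σ • ((X : W.xDivisionField 3) : AlgebraicClosure K) = ((X : W.xDivisionField 3) : AlgebraicClosure K)) →
        (X : W.xDivisionField 3) ∈ T₁ := by
      intro X hX
      rw [hT₁, IntermediateField.mem_fixedField_iff]
      intro g hg
      obtain ⟨σ, hσ⟩ := absRestrictNormalHom_surjective' (W.xDivisionField 3) g
      apply Subtype.ext
      rw [hresf g σ hσ]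
      exact hX g hg σ hσ
    have hRmemT : (⟨R, mR⟩ : W.xDivisionField 3) ∈ T₁ := by
      rw [hT₁, IntermediateField.mem_fixedField_iff]
      intro g hg
      obtain ⟨σ, hσ⟩ := absRestrictNormalHom_surjective' (W.xDivisionField 3) g
      apply Subtype.ext
      rw [hresf g σ hσ]
      exact hfixR g hg σ hσ
    have hinjT : Function.Injective (algebraMap T₁ (W.xDivisionField 3)) := (algebraMap T₁ (W.xDivisionField 3)).injective
    haveI hIST : IsScalarTower (𝓞 K) T₁ (W.xDivisionField 3) := IsScalarTower.of_algebraMap_eq (fun x => rfl)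
    -- integral elements of `T₁`
    have hint : ∀ (X : integralClosure (𝓞 K) (W.xDivisionField 3)) (hX : (X : W.xDivisionField 3) ∈ T₁),
        _root_.IsIntegral (𝓞 K) (⟨(X : W.xDivisionField 3), hX⟩ : T₁) := by
      intro X hX
      rw [← isIntegral_algebraMap_iff hinjT]
      exact X.2
    set AT : integralClosure (𝓞 K) T₁ := ⟨⟨(A : W.xDivisionField 3), hmemT A hfixA⟩, hint A _⟩ with hAT
    set sT : integralClosure (𝓞 K) T₁ := ⟨⟨(s : W.xDivisionField 3), hmemT s hfixs⟩, hint s _⟩ with hsT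
    have hRTint : _root_.IsIntegral (𝓞 K) (⟨(⟨R, mR⟩ : W.xDivisionField 3), hRmemT⟩ : T₁) := by
      refine IsIntegral.of_pow two_pos ?_
      have hsq : (⟨(⟨R, mR⟩ : W.xDivisionField 3), hRmemT⟩ : T₁) ^ 2 = ⟨(A : W.xDivisionField 3), hmemT A hfixA⟩ := by
        apply Subtype.ext; apply Subtype.ext
        push_cast
        exact hAR.symm
      rw [hsq]
      exact hint A _
    set RT : integralClosure (𝓞 K) T₁ := ⟨⟨(⟨R, mR⟩ : W.xDivisionField 3), hRmemT⟩, hRTint⟩ with hRT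
    set πT : integralClosure (𝓞 K) T₁ := algebraMap (𝓞 K) (integralClosure (𝓞 K) T₁) π with hπT
    -- the transfer `S_{T₁} → S_E`
    letI algT : Algebra (integralClosure (𝓞 K) T₁) (integralClosure (𝓞 K) (W.xDivisionField 3)) :=
      integralClosureAlgebra (𝓞 K) T₁
    haveI hDDT : IsDedekindDomain (integralClosure (𝓞 K) T₁) := integralClosure.isDedekindDomain (𝓞 K) K T₁
    have hmapA : algebraMap (integralClosure (𝓞 K) T₁) (integralClosure (𝓞 K) (W.xDivisionField 3)) AT = A := by
      apply Subtype.ext; rfl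
    have hmaps : algebraMap (integralClosure (𝓞 K) T₁) (integralClosure (𝓞 K) (W.xDivisionField 3)) sT = s := by
      apply Subtype.ext; rfl
    have hmapπ : algebraMap (integralClosure (𝓞 K) T₁) (integralClosure (𝓞 K) (W.xDivisionField 3)) πT =
        algebraMap (𝓞 K) (integralClosure (𝓞 K) (W.xDivisionField 3)) π := by
      apply Subtype.ext; rfl
    have hmapR : ((algebraMap (integralClosure (𝓞 K) T₁) (integralClosure (𝓞 K) (W.xDivisionField 3)) RT :
        integralClosure (𝓞 K) (W.xDivisionField 3)) : W.xDivisionField 3) = ⟨R, mR⟩ := rfl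
    obtain ⟨e', he'⟩ : ∃ e' : ℕ, e' = @Ideal.ramificationIdx' _ _ _ _ algT
        (@Ideal.under _ _ _ _ algT (𝔓.comap ((W.xDivisionField 3).integralClosureToAbsIntegers (𝓞 K))))
        (𝔓.comap ((W.xDivisionField 3).integralClosureToAbsIntegers (𝓞 K))) := ⟨_, rfl⟩
    have htr : ∀ X : integralClosure (𝓞 K) T₁,
        ord (𝔓.comap ((W.xDivisionField 3).integralClosureToAbsIntegers (𝓞 K)))
          (algebraMap (integralClosure (𝓞 K) T₁) (integralClosure (𝓞 K) (W.xDivisionField 3)) X) =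
        e' * ord (@Ideal.under _ _ _ _ algT (𝔓.comap ((W.xDivisionField 3).integralClosureToAbsIntegers (𝓞 K)))) X := by
      intro X
      rw [he']
      exact ord_algebraMap_integralClosure (𝓞 K) T₁ (K := K) (L := W.xDivisionField 3) _ hPE0 X
    -- `e' = #Q₁`
    have he'card : e' = Nat.card Q1 := by
      have h := ramificationIdx'_under_eq_card_inertia (𝓞 K) T₁ (K := K) (L := W.xDivisionField 3) _ hPE0
      rw [← he'] at h
      rw [h]
      -- every element of `T₁.fixingSubgroup = Q₁` lies in the inertia group
      have htop : (𝔓.comap ((W.xDivisionField 3).integralClosureToAbsIntegers (𝓞 K))).inertia T₁.fixingSubgroup = ⊤ := by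
        rw [eq_top_iff]
        intro x _
        rw [← Ideal.ramificationSubgroup_zero, mem_ramificationSubgroup_subgroup_iff, Ideal.ramificationSubgroup_zero]
        have hx : (x : W.xDivisionField 3 ≃ₐ[K] W.xDivisionField 3) ∈ Q1 := by rw [← hfixT]; exact x.2
        have := hQ10 _ hx
        rwa [Ideal.ramificationSubgroup_zero] at this
      rw [htop, Subgroup.card_top, hfixT]
    have he'pos : 0 < e' := by rw [he'card]; exact Nat.card_pos
    have he'0 : (e' : ℕ∞) ≠ 0 := by exact_mod_cast he'pos.ne'
    -- `#Q₀ = e' · v_T(π_T)` with `v_T(π_T)` odd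
    have hπT' : ((Nat.card ((𝔓.comap ((W.xDivisionField 3).integralClosureToAbsIntegers (𝓞 K))).ramificationSubgroup
        (W.xDivisionField 3 ≃ₐ[K] W.xDivisionField 3) 0) : ℕ) : ℕ∞) =
        e' * ord (@Ideal.under _ _ _ _ algT (𝔓.comap ((W.xDivisionField 3).integralClosureToAbsIntegers (𝓞 K)))) πT := by
      rw [← hordπ, ← hmapπ, htr]
    have hfinπ : ord (@Ideal.under _ _ _ _ algT (𝔓.comap ((W.xDivisionField 3).integralClosureToAbsIntegers (𝓞 K)))) πT ≠ ⊤ := by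
      intro h
      rw [h, ENat.mul_top he'0] at hπT'
      exact ENat.coe_ne_top _ hπT'
    obtain ⟨eT, heT⟩ := ENat.ne_top_iff_exists.mp hfinπ
    have hmul : Nat.card ((𝔓.comap ((W.xDivisionField 3).integralClosureToAbsIntegers (𝓞 K))).ramificationSubgroup
        (W.xDivisionField 3 ≃ₐ[K] W.xDivisionField 3) 0) = e' * eT := by
      rw [← heT] at hπT'
      exact_mod_cast hπT'
    set a := (Nat.card ((𝔓.comap ((W.xDivisionField 3).integralClosureToAbsIntegers (𝓞 K))).ramificationSubgroup
      (W.xDivisionField 3 ≃ₐ[K] W.xDivisionField 3) 0)).factorization 2 with ha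
    have heTodd : Odd eT := by
      rw [Nat.odd_iff]
      by_contra hne
      have h2 : 2 ∣ eT := Nat.dvd_of_mod_eq_zero (by omega)
      obtain ⟨m, hm⟩ := h2
      have hN0 : Nat.card ((𝔓.comap ((W.xDivisionField 3).integralClosureToAbsIntegers (𝓞 K))).ramificationSubgroup
          (W.xDivisionField 3 ≃ₐ[K] W.xDivisionField 3) 0) ≠ 0 := Nat.card_pos.ne'
      have hdvd : 2 ^ (a + 1) ∣ Nat.card ((𝔓.comap ((W.xDivisionField 3).integralClosureToAbsIntegers (𝓞 K))).ramificationSubgroup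
          (W.xDivisionField 3 ≃ₐ[K] W.xDivisionField 3) 0) :=
        ⟨m, by rw [hmul, he'card, hcardpow, hm]; ring⟩
      have := (Nat.Prime.pow_dvd_iff_le_factorization Nat.prime_two hN0).mp hdvd
      omega
    -- transfer of `ht` and `hle` to `T₁`
    have htA : ord (𝔓.comap ((W.xDivisionField 3).integralClosureToAbsIntegers (𝓞 K))) (A - s ^ 2) =
        e' * ord (@Ideal.under _ _ _ _ algT (𝔓.comap ((W.xDivisionField 3).integralClosureToAbsIntegers (𝓞 K)))) (AT - sT ^ 2) := by
      rw [← hmapA, ← hmaps, ← map_pow, ← map_sub, htr]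
    have ht2s : ord (𝔓.comap ((W.xDivisionField 3).integralClosureToAbsIntegers (𝓞 K))) (2 * s) =
        e' * ord (@Ideal.under _ _ _ _ algT (𝔓.comap ((W.xDivisionField 3).integralClosureToAbsIntegers (𝓞 K)))) (2 * sT) := by
      rw [show (2 : integralClosure (𝓞 K) (W.xDivisionField 3)) * s =
        algebraMap (integralClosure (𝓞 K) T₁) (integralClosure (𝓞 K) (W.xDivisionField 3)) (2 * sT) by
          rw [map_mul, map_ofNat, hmaps], htr]
    have he₀0 : (e₀ : ℕ∞) ≠ 0 := by
      obtain ⟨k, hk⟩ := he₀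
      exact_mod_cast (show e₀ ≠ 0 by omega)
    have hfinA : ord (@Ideal.under _ _ _ _ algT (𝔓.comap ((W.xDivisionField 3).integralClosureToAbsIntegers (𝓞 K)))) (AT - sT ^ 2) ≠ ⊤ := by
      intro h
      rw [htA, h, ENat.mul_top he'0, ENat.mul_top he₀0, hordπ, ← Nat.cast_mul] at ht
      exact ENat.top_ne_coe _ ht
    obtain ⟨u, hu⟩ := ENat.ne_top_iff_exists.mp hfinA
    have hkey : e₀ * (e' * u) = t * Nat.card ((𝔓.comap ((W.xDivisionField 3).integralClosureToAbsIntegers (𝓞 K))).ramificationSubgroup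
        (W.xDivisionField 3 ≃ₐ[K] W.xDivisionField 3) 0) := by
      rw [htA, ← hu, hordπ] at ht
      exact_mod_cast ht
    have hkey' : e₀ * u = t * eT := by
      apply Nat.eq_of_mul_eq_mul_left he'pos
      calc e' * (e₀ * u) = e₀ * (e' * u) := by ring
        _ = t * (e' * eT) := by rw [hkey, hmul]
        _ = e' * (t * eT) := by ring
    -- `2 v_T(R_T - s_T) = u`
    haveI := integralClosure_isIntegral (𝓞 K) T₁ (K := K) (L := W.xDivisionField 3)
    have hPT0 : (@Ideal.under _ _ _ _ algT (𝔓.comap ((W.xDivisionField 3).integralClosureToAbsIntegers (𝓞 K)))) ≠ ⊥ :=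
      Ideal.IsIntegral.comap_ne_bot _ hPE0
    haveI hPTmax := isMaximal_under_integralClosure (𝓞 K) T₁ (𝔓.comap ((W.xDivisionField 3).integralClosureToAbsIntegers (𝓞 K)))
    have hsqT : RT ^ 2 = AT := by
      apply Subtype.ext; apply Subtype.ext; apply Subtype.ext
      push_cast
      exact hAR.symm
    have hleT : (u : ℕ∞) ≤ 2 * ord (@Ideal.under _ _ _ _ algT (𝔓.comap ((W.xDivisionField 3).integralClosureToAbsIntegers (𝓞 K)))) (2 * sT) := by
      rw [htA, ht2s, ← hu] at hle
      generalize hb : ord (@Ideal.under _ _ _ _ algT (𝔓.comap ((W.xDivisionField 3).integralClosureToAbsIntegers (𝓞 K)))) (2 * sT) = b at hle ⊢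
      induction b using ENat.recTopCoe with
      | top => rw [ENat.mul_top (by norm_num)]; exact le_top
      | coe b =>
        have h' : e' * u ≤ 2 * (e' * b) := by exact_mod_cast hle
        have : u ≤ 2 * b := by nlinarith
        exact_mod_cast this
    have h2u : 2 * ord (@Ideal.under _ _ _ _ algT (𝔓.comap ((W.xDivisionField 3).integralClosureToAbsIntegers (𝓞 K)))) (RT - sT) = u :=
      two_mul_ord_sub_eq_of_le _ hPT0 (by rw [hsqT, ← hu]) hleT
    have hfinR : ord (@Ideal.under _ _ _ _ algT (𝔓.comap ((W.xDivisionField 3).integralClosureToAbsIntegers (𝓞 K)))) (RT - sT) ≠ ⊤ := by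
      intro h
      rw [h, ENat.mul_top (by norm_num)] at h2u
      exact ENat.top_ne_coe _ h2u
    obtain ⟨w, hw⟩ := ENat.ne_top_iff_exists.mp hfinR
    have h2w : 2 * w = u := by
      rw [← hw] at h2u
      exact_mod_cast h2u
    -- parity
    have hodd : Odd (e₀ * u) := by rw [hkey']; exact hto.mul heTodd
    have heven : Even (e₀ * u) := ⟨e₀ * w, by rw [← h2w]; ring⟩
    exact (Nat.not_even_iff_odd.mpr hodd) heven
  -- values of `A_k = (q_k R_k)²` are fixed by lifts of `Q₁` (`σ R_k = ± R_k`)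
  have hnumσ : ∀ (σ : absoluteGaloisGroup K) (m : ℕ), σ • ((m : AlgebraicClosure K)) = m := fun σ m ↦ by
    rw [show ((m : AlgebraicClosure K)) = algebraMap K (AlgebraicClosure K) m from (map_natCast _ m).symm]
    exact smul_algebraMap σ (m : K)
  have hfixA : ∀ (A : integralClosure (𝓞 K) (W.xDivisionField 3)) (q R : AlgebraicClosure K),
      ((A : W.xDivisionField 3) : AlgebraicClosure K) = (q * R) ^ 2 →
      (∀ σ : absoluteGaloisGroup K, σ • ζ = ζ → σ • δ = δ → σ • q = q) →
      (∀ σ : absoluteGaloisGroup K, σ • ζ = ζ → σ • δ = δ → σ • R = R ∨ σ • R = -R) →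
      ∀ g, g ∈ Q1 → ∀ σ : absoluteGaloisGroup K, absRestrictNormalHom (W.xDivisionField 3) σ = g →
        σ • ((A : W.xDivisionField 3) : AlgebraicClosure K) = ((A : W.xDivisionField 3) : AlgebraicClosure K) := by
    intro A q R hA hq hR g hg σ hσ
    obtain ⟨fζ, fδ⟩ := hliftfix g hg σ hσ
    rw [hA, smul_pow', smul_mul', hq σ fζ fδ]
    rcases hR σ fζ fδ with h | h
    · rw [h]
    · rw [h]; ring
  have hsR₀ : ∀ σ : absoluteGaloisGroup K, σ • ζ = ζ → σ • δ = δ → σ • R₀ = R₀ ∨ σ • R₀ = -R₀ :=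
    fun σ a b => (W.smul_radical_eq_or_eq_neg h₀ h₁ h₂ a b).1
  have hsR₁ : ∀ σ : absoluteGaloisGroup K, σ • ζ = ζ → σ • δ = δ → σ • R₁ = R₁ ∨ σ • R₁ = -R₁ :=
    fun σ a b => (W.smul_radical_eq_or_eq_neg h₀ h₁ h₂ a b).2.1
  have hsR₂ : ∀ σ : absoluteGaloisGroup K, σ • ζ = ζ → σ • δ = δ → σ • R₂ = R₂ ∨ σ • R₂ = -R₂ :=
    fun σ a b => (W.smul_radical_eq_or_eq_neg h₀ h₁ h₂ a b).2.2
  -- `q_k R_k ∈ E` is fixed when `R_k` is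
  have hqR : ∀ (q R : AlgebraicClosure K),
      (∀ σ : absoluteGaloisGroup K, σ • ζ = ζ → σ • δ = δ → σ • q = q) →
      ∀ g, g ∈ Q1 → ∀ σ : absoluteGaloisGroup K, absRestrictNormalHom (W.xDivisionField 3) σ = g →
        σ • R = R → σ • (q * R) = q * R := by
    intro q R hq g hg σ hσ hR
    obtain ⟨fζ, fδ⟩ := hliftfix g hg σ hσ
    rw [smul_mul', hq σ fζ fδ, hR]
  have hfixs : ∀ (s : integralClosure (𝓞 K) (W.xDivisionField 3)),
      (∀ σ : absoluteGaloisGroup K, σ • ζ = ζ → σ • δ = δ →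
        σ • ((s : W.xDivisionField 3) : AlgebraicClosure K) = ((s : W.xDivisionField 3) : AlgebraicClosure K)) →
      ∀ g, g ∈ Q1 → ∀ σ : absoluteGaloisGroup K, absRestrictNormalHom (W.xDivisionField 3) σ = g →
        σ • ((s : W.xDivisionField 3) : AlgebraicClosure K) = ((s : W.xDivisionField 3) : AlgebraicClosure K) := by
    intro s hs g hg σ hσ
    obtain ⟨fζ, fδ⟩ := hliftfix g hg σ hσ
    exact hs σ fζ fδ
  -- lifts of the same `g` agree on `E`
  have hlifts : ∀ (g : W.xDivisionField 3 ≃ₐ[K] W.xDivisionField 3) (σ σ' : absoluteGaloisGroup K),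
      absRestrictNormalHom (W.xDivisionField 3) σ = g → absRestrictNormalHom (W.xDivisionField 3) σ' = g →
      ∀ (R : AlgebraicClosure K), R ∈ W.xDivisionField 3 → σ • R = σ' • R := by
    intro g σ σ' hσ hσ' R hR
    rw [← hresf g σ hσ ⟨R, hR⟩, ← hresf g σ' hσ' ⟨R, hR⟩]
  have hone_fix : ∀ (σ : absoluteGaloisGroup K), absRestrictNormalHom (W.xDivisionField 3) σ = 1 →
      ∀ (R : AlgebraicClosure K), R ∈ W.xDivisionField 3 → σ • R = R := by
    intro σ hσ R hR
    rw [← hresf 1 σ hσ ⟨R, hR⟩, AlgEquiv.one_apply]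
  -- `#Q₁ ∈ {1, 2, 4}`; exclude `1` and `2`
  set a := (Nat.card ((𝔓.comap ((W.xDivisionField 3).integralClosureToAbsIntegers (𝓞 K))).ramificationSubgroup
    (W.xDivisionField 3 ≃ₐ[K] W.xDivisionField 3) 0)).factorization 2 with ha
  by_contra hne4
  have ha1 : a ≤ 1 := by
    by_contra h
    have h2 : 2 ≤ a := by omega
    have h4 : 4 ≤ Nat.card Q1 := by
      rw [hcardpow]
      calc 4 = 2 ^ 2 := by norm_num
        _ ≤ 2 ^ a := Nat.pow_le_pow_right two_pos h2
    exact hne4 (le_antisymm hle4 h4)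
  interval_cases a
  · -- `#Q₁ = 1`: `Q₁ = 1` fixes `R₀`
    rw [pow_zero] at hcardpow
    have hbot : Q1 = ⊥ := Subgroup.card_eq_one.mp hcardpow
    refine core (q₀ * R₀) (mul_mem mq₀ mR₀) A₀ s₀ t₀ hA₀ ?_ (hfixA A₀ q₀ R₀ hA₀ hq₀ hsR₀) (hfixs s₀ hs₀) hto₀ ht₀ hle₀
    intro g hg σ hσ
    rw [hbot, Subgroup.mem_bot] at hg
    rw [hg] at hσ
    exact hone_fix σ hσ (q₀ * R₀) (mul_mem mq₀ mR₀)
  · -- `#Q₁ = 2`: `Q₁ = {1, τ}` with `τ` an even sign change `≠ 1`, fixing exactly one `R_k`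
    rw [pow_one] at hcardpow
    obtain ⟨τ, hτ1, hτu⟩ := (Nat.card_eq_two_iff' (1 : Q1)).mp hcardpow
    obtain ⟨στ, hστ⟩ := absRestrictNormalHom_surjective' (W.xDivisionField 3) (τ : W.xDivisionField 3 ≃ₐ[K] W.xDivisionField 3)
    obtain ⟨fζ, fδ⟩ := hliftfix _ τ.2 στ hστ
    obtain ⟨s0, s1, s2⟩ := W.smul_radical_eq_or_eq_neg h₀ h₁ h₂ fζ fδ
    -- every `g ∈ Q₁` is `1` or `τ`
    have hcases : ∀ g, g ∈ Q1 → g = 1 ∨ g = (τ : W.xDivisionField 3 ≃ₐ[K] W.xDivisionField 3) := by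
      intro g hg
      by_cases h1 : (⟨g, hg⟩ : Q1) = 1
      · exact Or.inl (congrArg Subtype.val h1)
      · exact Or.inr (congrArg Subtype.val (hτu ⟨g, hg⟩ h1))
    have hfix_of : ∀ (R : AlgebraicClosure K), R ∈ W.xDivisionField 3 → στ • R = R →
        ∀ g, g ∈ Q1 → ∀ σ : absoluteGaloisGroup K, absRestrictNormalHom (W.xDivisionField 3) σ = g → σ • R = R := by
      intro R hR hτR g hg σ hσ
      rcases hcases g hg with h | h
      · rw [h] at hσ
        exact hone_fix σ hσ R hR
      · rw [h] at hσ
        rw [hlifts _ σ στ hσ hστ R hR]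
        exact hτR
    -- `τ ≠ 1` as an automorphism
    have hτne : (τ : W.xDivisionField 3 ≃ₐ[K] W.xDivisionField 3) ≠ 1 := fun h => hτ1 (Subtype.ext h)
    have h2' : (2 : AlgebraicClosure K) ≠ 0 := two_ne_zero
    have hprodne : R₀ * R₁ * R₂ ≠ 0 := mul_ne_zero (mul_ne_zero hRne.1 hRne.2.1) hRne.2.2
    have hρτ := hρσ στ
    rcases s0 with e0 | e0 <;> rcases s1 with e1 | e1 <;> rcases s2 with e2 | e2 <;>
      rw [e0, e1, e2] at hρτ
    · -- (+,+,+): `τ = 1`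
      exact hτne (W.algEquiv_xDivisionField_three_eq_of_smul_radical_eq hζ hδ h₀ h₁ h₂ hρ hc₆ hστ (map_one _)
        (by rw [e0, one_smul]) (by rw [e1, one_smul]))
    · exact hprodne (by linear_combination (-(1 / 2) : AlgebraicClosure K) * hρτ)
    · exact hprodne (by linear_combination (-(1 / 2) : AlgebraicClosure K) * hρτ)
    · -- (+,-,-): `k = 0`
      exact core (q₀ * R₀) (mul_mem mq₀ mR₀) A₀ s₀ t₀ hA₀
        (fun g hg σ hσ => hqR q₀ R₀ hq₀ g hg σ hσ (hfix_of R₀ mR₀ e0 g hg σ hσ))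
        (hfixA A₀ q₀ R₀ hA₀ hq₀ hsR₀) (hfixs s₀ hs₀) hto₀ ht₀ hle₀
    · exact hprodne (by linear_combination (-(1 / 2) : AlgebraicClosure K) * hρτ)
    · -- (-,+,-): `k = 1`
      exact core (q₁ * R₁) (mul_mem mq₁ mR₁) A₁ s₁ t₁ hA₁
        (fun g hg σ hσ => hqR q₁ R₁ hq₁ g hg σ hσ (hfix_of R₁ mR₁ e1 g hg σ hσ))
        (hfixA A₁ q₁ R₁ hA₁ hq₁ hsR₁) (hfixs s₁ hs₁) hto₁ ht₁ hle₁
    · -- (-,-,+): `k = 2`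
      exact core (q₂ * R₂) (mul_mem mq₂ mR₂) A₂ s₂ t₂ hA₂
        (fun g hg σ hσ => hqR q₂ R₂ hq₂ g hg σ hσ (hfix_of R₂ mR₂ e2 g hg σ hσ))
        (hfixA A₂ q₂ R₂ hA₂ hq₂ hsR₂) (hfixs s₂ hs₂) hto₂ ht₂ hle₂
    · exact hprodne (by linear_combination (-(1 / 2) : AlgebraicClosure K) * hρτ)


end WeierstrassCurve

end
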